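import Summits.QuantumFields.YangMills.Theorems.FluctuationComparisonRegPrIntLS2BetaArcLetterOfGuard
import HarnessLib

/-!
# S2β · THE ⁗ ADAPTER OF THE ARC-PROFILE SUPPLIER: `hARC⁗` AT A GUARD WITH THE SMALL-BOND CONJUNCT, as a CLOSED TERM — ✓p835602 `arcLetter_of_guard` with the (E5) Σ-window line
# inserted (and ignored): the per-guard socket `hARC` of LEAD's v5 `supTowerLetter4_at (G) (hARC) (hDBX)` is INHABITED at every `G` carrying `G F J V → ∀ e, ‖logVec (su2Quat (V e))‖ ≤ 1∕128`

Cell `ym3-torus` (YM ladder rung R3 = continuum `SU(2)` Yang–Mills on the three-torus at fixed lattice data — a RUNG: NOT d = 4, NOT infinite volume, NOT a mass gap, NOT Clay).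
Width seat `ym-ust-20520-w5` (gen 28), helper on crux `stmt-QuantumFields-20520`, LINE g18-1 S2β; `--kind proof --supports stmt-QuantumFields-20520 --as helper`, count-neutral,
DEFINITION-FREE (0 `def`, 0 `instance`, 0 `notation`, 0 `sorry`); ONE decl-local `set_option maxHeartbeats 400000 in` (the letter-sized binder, as the knits).

WHY (LEAD w3 g29 №19 (2)(i) ∕ №24 RULING №64 «PER-GUARD SOCKETS» ∕ №26; architect-lineage px17 g23 RULING «GUARDED STRATA + ONE NAMED BRIDGE» (R2): «its `hARC` inputs are then CLOSED
TERMS `arcLetter_of_guard (G∧G_{s₀}) (fun … h => h.2)`»).  After (E5) every station-prefix letter carries ONE more guard line — `(∑ i ∈ Finset.range (K - J), ((5L)²∕4)·θ (K − i)) ≤ α →`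
right after the sup window — so the per-guard socket `hARC` of ✓`supTowerLetter4_at` (edition ⁗) is px12 g26's ✓p835602 `arcLetter_of_guard` conclusion PLUS that line.  The Σ-window
is a hypothesis the arc-profile supplier does not need (its bootstrap uses the SUP window only — ✓p835602's header: «THE POINT OF THIS FILE: the SUP profile needs only the sup
window»), so the ⁗ letter follows from the ‴ one by introducing and discarding it.  THIS FILE is that adapter and nothing else; with it, at both GAUGE-FIXED strata
`G_IRR ∧ G_{s₀}`, `G_A′ ∧ G_{s₀}` (`s₀ ≤ 1∕128`) the `hARC` socket of the per-guard knit is a closed term, and the composed gap list reads GAP♯∘ ⟸ {h3, hD×2, hDBX×2, hsupp×2}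
(LEAD №26 «(ii)-AT»).  The guard-UNIFORM binder `∀ G, hARC⁗ G` stays refuted (✓`not_forall_guard_arcLetter4`, LEAD №23): this file speaks of guarded `G` only.

WHAT IS PROVED (sorry-free).  ★★★ `arcLetter4_of_guard (G) (hGs) : ⟨the `hARC` binder TYPE of ✓`supTowerLetter4_at` at `G`, byte for byte⟩` — and the `s₀`-generic corollary
★★ `arcLetter4_of_smallBondGuard (G) (s₀) (hs₀ : s₀ ≤ 1∕128) (hGs : G F J V → ∀ e, ‖…‖ ≤ s₀)` (RULING №114: `s₀` is a supplier parameter).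

HONEST SCOPE.  A binder-threading adapter over ✓p835602; the window∕(BKG)∕(E4)∕AxStage clauses are HYPOTHESES of the letter; nothing of Bałaban's renormalisation-group analysis is
asserted or proved ([Balaban1985RegularSpaces] Lemma 1 (1.24)–(1.26) p.79, (1.29) p.81 — the printed small-field regularity this profile imitates; [Balaban1985Averaging] Prop. 4
(128)–(135) pp.37–38); D-GUARD (for guards WITHOUT the small-bond conjunct), `hsupp`, `hDBX`, GAP♯∘ (`stub_uniformFibreGapOrbit`, registry 3732b7df UNTOUCHED), the five registered stubs
(0∕5), S2β, 20520, 19936, 19200, `YM3TorusSU2` are NOT proved; no registered stub is closed; rung R3 — NOT d = 4, NOT infinite volume, NOT a mass gap, NOT Clay; the Yang–Mills mass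
gap is NOT proved.
-/

set_option autoImplicit false

noncomputable section

namespace Summit.QuantumFields.YangMills.Theorems.FluctuationComparisonRegPrIntLS2BetaArcLetterSigmaOfGuard

open Finset
open scoped Real
open Literature.MathematicalPhysics.QuantumLattice (su2Quat)
open Literature.MathematicalPhysics.QuantumFieldTheory.Balaban1983to89
open T4Continuum T3ContinuumYM3Torus T3UnitScaleTilt T3TiltDescent T3LevelShift BlockAveraging
open T4CubeChartGnomonic (SU2)
open T4HaarSU2ExpChart (expPoint)
open T4ExpWindowSmallField (logVec)
open T3UnitLawDensityEML (ℰp)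
open T3ConstrainedMinimiser (fibre)
open ExpMeanLog (deltaSU)
open B10Eq27TorusAxialLog (rel axialT)
open Summit.QuantumFields.YangMills.Theorems.FluctuationComparisonRegPrIntLS2BetaArcLetterOfGuard (arcLetter_of_guard)

set_option maxHeartbeats 400000 in
/-- ★★★ **THE ⁗ ARC-PROFILE LETTER AT A GUARDED CLASS, CLOSED**: for every datum class `G` carrying the small-bond conjunct `G F J V → ∀ e, ‖logVec (su2Quat (V e))‖ ≤ 1∕128`, the
`hARC` socket of ✓`supTowerLetter4_at G` (= ✓p835602's conclusion with the (E5) Σ-window line inserted after the sup window) holds — the Σ-window is introduced and discarded.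
[cite: Balaban1985RegularSpaces, Lemma 1 (1.24)-(1.26) p.79, (1.29) p.81; Balaban1985Averaging, Prop. 4 (128)-(135) pp.37-38] -/
theorem arcLetter4_of_guard
    (G : (F : T3Family) → (J : ℕ) → GaugeField (F.P J) 0 (Matrix.specialUnitaryGroup (Fin 2) ℂ) → Prop)
    (hGs : ∀ (F : T3Family) (J : ℕ) (V : GaugeField (F.P J) 0 (Matrix.specialUnitaryGroup (Fin 2) ℂ)),
      G F J V → ∀ e, ‖logVec (su2Quat (V e))‖ ≤ 1 / 128) :

      ∀ (L : ℕ), 1 < L → ∀ (C_B : ℝ), 0 ≤ C_B → ∃ α₀ : ℝ, 0 < α₀ ∧ ∀ (F : T3Family), F.L = L →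
      ∀ (J K : ℕ) (hJK : J ≤ K) (θ : ℕ → ℝ), (∀ i, 0 ≤ θ i) → ∀ (α : ℝ), (∀ i, J < i → i ≤ K → (((5 * F.L : ℕ) : ℝ) ^ 2 / 4) * θ i ≤ α) →
        (∑ i ∈ Finset.range (K - J), (((5 * F.L : ℕ) : ℝ) ^ 2 / 4) * θ (K - i)) ≤ α →
        α ≤ 1 / 24 → α < deltaSU (Fin 2) → 157 * α < ((F.L : ℝ) ^ 2)⁻¹ → α ≤ α₀ →
        ∀ U₀ : GaugeField (F.P K) 0 (Matrix.specialUnitaryGroup (Fin 2) ℂ), U₀ ∈ histGood F ℰp θ K J →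
        G F J (descendTo F ℰp J K hJK U₀) →
        (∀ t, t ≤ K - J → ∀ p : Plaq (F.P K) t,
          dist1 (GaugeField.plaqHol (Averaging.iter (fun k => BlockAveraging.blockAvg (P := F.P K) (j := k) ℰp) t U₀) p) ≤
            C_B * α * (F.L : ℝ) ^ (2 * t) * ((F.L : ℝ)⁻¹) ^ (2 * (K - J))) →
        ∀ ζ : PBond (F.P K) 0 → EuclideanSpace ℝ (Fin 3), (∀ ℓ, ‖ζ ℓ‖ ≤ Real.pi) →
          (fun ℓ => expPoint (ζ ℓ) * U₀ ℓ : GaugeField (F.P K) 0 (Matrix.specialUnitaryGroup (Fin 2) ℂ)) ∈ histGood F ℰp θ K J →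
            descendTo F ℰp J K hJK (fun ℓ => expPoint (ζ ℓ) * U₀ ℓ : GaugeField (F.P K) 0 (Matrix.specialUnitaryGroup (Fin 2) ℂ)) = descendTo F ℰp J K hJK U₀ →
            ∀ (wt : (j : ℕ) → PBond (F.P K) j → PBond (F.P K) (j + 1) → ℝ)
            (lift : (j : ℕ) → GaugeField (F.P K) (j + 1) SU2 → GaugeField (F.P K) j SU2)
            (U₁ : GaugeField (F.P K) 0 SU2) (g g₀ : (j : ℕ) → Site (F.P K) j → SU2),
          (∀ j b e, wt j b e = if e.dir = b.dir ∧ (b.src b.dir - emb e.src b.dir).val < (F.P K).L then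
              ∏ ν ∈ Finset.univ.erase b.dir, max 0 (1 - ((rel (emb e.src) b.src ν).natAbs : ℝ) / (F.P K).L) else 0) →
          (∀ j X b, lift j X b = expPoint (∑ e, wt j b e • ((((F.P K).L : ℕ) : ℝ)⁻¹ • logVec (su2Quat (X e))))) →
          (∀ j, j < K - J → ∀ x, g j x =
            (axialT (lift j (GaugeField.gaugeAct (g (j + 1)) (Averaging.iter (fun k => blockAvg (P := F.P K) (j := k) ℰp) (j + 1) (fun ℓ => expPoint (ζ ℓ) * U₀ ℓ))))
                (emb (blockOf x)) x)⁻¹ *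
              g (j + 1) (blockOf x) * axialT (Averaging.iter (fun k => blockAvg (P := F.P K) (j := k) ℰp) j (fun ℓ => expPoint (ζ ℓ) * U₀ ℓ)) (emb (blockOf x)) x) →
          (∀ j, K - J ≤ j → ∀ y, g j y = 1) →
          (∀ j, j < K - J → ∀ y : Site (F.P K) (j + 1), g j (emb y) = g (j + 1) y) →
          (∀ X : GaugeField (F.P K) 0 SU2, ∀ j, j ≤ K - J →
            Averaging.iter (fun k => blockAvg (P := F.P K) (j := k) ℰp) j (GaugeField.gaugeAct (g 0) X) =
              GaugeField.gaugeAct (g j) (Averaging.iter (fun k => blockAvg (P := F.P K) (j := k) ℰp) j X)) →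
          (∀ j, j < K - J → ∀ x,
            axialT (GaugeField.gaugeAct (g j) (Averaging.iter (fun k => blockAvg (P := F.P K) (j := k) ℰp) j (fun ℓ => expPoint (ζ ℓ) * U₀ ℓ))) (emb (blockOf x)) x =
              axialT (lift j (GaugeField.gaugeAct (g (j + 1)) (Averaging.iter (fun k => blockAvg (P := F.P K) (j := k) ℰp) (j + 1) (fun ℓ => expPoint (ζ ℓ) * U₀ ℓ))))
                (emb (blockOf x)) x) →
          (∀ j, j < K - J →
            (blockAvg (P := F.P K) (j := j) ℰp).avg (GaugeField.gaugeAct (g j) (Averaging.iter (fun k => blockAvg (P := F.P K) (j := k) ℰp) j (fun ℓ => expPoint (ζ ℓ) * U₀ ℓ))) =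
              GaugeField.gaugeAct (g (j + 1)) (Averaging.iter (fun k => blockAvg (P := F.P K) (j := k) ℰp) (j + 1) (fun ℓ => expPoint (ζ ℓ) * U₀ ℓ))) →
          (∀ j, j < K - J → ∀ x, g₀ j x =
            (axialT (lift j (GaugeField.gaugeAct (g₀ (j + 1)) (Averaging.iter (fun k => blockAvg (P := F.P K) (j := k) ℰp) (j + 1) U₁)))
                (emb (blockOf x)) x)⁻¹ *
              g₀ (j + 1) (blockOf x) * axialT (Averaging.iter (fun k => blockAvg (P := F.P K) (j := k) ℰp) j U₁) (emb (blockOf x)) x) →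
          (∀ j, K - J ≤ j → ∀ y, g₀ j y = 1) →
          (∀ j, j < K - J → ∀ y : Site (F.P K) (j + 1), g₀ j (emb y) = g₀ (j + 1) y) →
          (∀ X : GaugeField (F.P K) 0 SU2, ∀ j, j ≤ K - J →
            Averaging.iter (fun k => blockAvg (P := F.P K) (j := k) ℰp) j (GaugeField.gaugeAct (g₀ 0) X) =
              GaugeField.gaugeAct (g₀ j) (Averaging.iter (fun k => blockAvg (P := F.P K) (j := k) ℰp) j X)) →
          (∀ j, j < K - J → ∀ x,
            axialT (GaugeField.gaugeAct (g₀ j) (Averaging.iter (fun k => blockAvg (P := F.P K) (j := k) ℰp) j U₁)) (emb (blockOf x)) x =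
              axialT (lift j (GaugeField.gaugeAct (g₀ (j + 1)) (Averaging.iter (fun k => blockAvg (P := F.P K) (j := k) ℰp) (j + 1) U₁)))
                (emb (blockOf x)) x) →
          (∀ j, j < K - J →
            (blockAvg (P := F.P K) (j := j) ℰp).avg (GaugeField.gaugeAct (g₀ j) (Averaging.iter (fun k => blockAvg (P := F.P K) (j := k) ℰp) j U₁)) =
              GaugeField.gaugeAct (g₀ (j + 1)) (Averaging.iter (fun k => blockAvg (P := F.P K) (j := k) ℰp) (j + 1) U₁)) →
          (∀ X : GaugeField (F.P K) 0 SU2, Averaging.iter (fun k => blockAvg (P := F.P K) (j := k) ℰp) (K - J) (GaugeField.gaugeAct (fun x => (g 0 x)⁻¹) X) = Averaging.iter (fun k => blockAvg (P := F.P K) (j := k) ℰp) (K - J) X) →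
          (∀ X : GaugeField (F.P K) 0 SU2, Averaging.iter (fun k => blockAvg (P := F.P K) (j := k) ℰp) (K - J) (GaugeField.gaugeAct (g₀ 0) X) = Averaging.iter (fun k => blockAvg (P := F.P K) (j := k) ℰp) (K - J) X) →
          U₀ = GaugeField.gaugeAct (fun x => (g 0 x)⁻¹ * g₀ 0 x) U₁ →

                      ∀ i, 1 ≤ i → i < K - J → ∀ e : PBond (F.P K) i,
            ‖logVec (su2Quat (GaugeField.gaugeAct (g i) (Averaging.iter (fun k => blockAvg (P := F.P K) (j := k) ℰp) i (fun ℓ => expPoint (ζ ℓ) * U₀ ℓ)) e))‖ ≤ 1 / 4 ∧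
            ‖logVec (su2Quat (GaugeField.gaugeAct (g₀ i) (Averaging.iter (fun k => blockAvg (P := F.P K) (j := k) ℰp) i U₁) e))‖ ≤ 1 / 4 := by
  intro L hL C_B hCB
  obtain ⟨α₀, hα₀, H⟩ := arcLetter_of_guard G hGs L hL C_B hCB
  exact ⟨α₀, hα₀, fun F hF J K hJK θ hθ α hwin _hsum => H F hF J K hJK θ hθ α hwin⟩

set_option maxHeartbeats 400000 in
/-- ★★ **`s₀`-GENERIC EDITION** (DESK RULING №114: `s₀` is a supplier parameter): any guard with `G F J V → ∀ e, ‖logVec (su2Quat (V e))‖ ≤ s₀`, `s₀ ≤ 1∕128`, inhabits the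
`hARC` socket of ✓`supTowerLetter4_at G` — in particular the GAUGE-FIXED strata `G₀ ∧ G_{s₀}` of the architect-lineage ruling (R1) with `hGs := fun F J V h e => (h.2 e).trans hs₀`.
[cite: Balaban1985RegularSpaces, (1.29) p.81; Balaban1985Averaging, Prop. 4 (128)-(135) pp.37-38] -/
theorem arcLetter4_of_smallBondGuard
    (G : (F : T3Family) → (J : ℕ) → GaugeField (F.P J) 0 (Matrix.specialUnitaryGroup (Fin 2) ℂ) → Prop) (s₀ : ℝ) (hs₀ : s₀ ≤ 1 / 128)
    (hGs : ∀ (F : T3Family) (J : ℕ) (V : GaugeField (F.P J) 0 (Matrix.specialUnitaryGroup (Fin 2) ℂ)),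
      G F J V → ∀ e, ‖logVec (su2Quat (V e))‖ ≤ s₀) :

      ∀ (L : ℕ), 1 < L → ∀ (C_B : ℝ), 0 ≤ C_B → ∃ α₀ : ℝ, 0 < α₀ ∧ ∀ (F : T3Family), F.L = L →
      ∀ (J K : ℕ) (hJK : J ≤ K) (θ : ℕ → ℝ), (∀ i, 0 ≤ θ i) → ∀ (α : ℝ), (∀ i, J < i → i ≤ K → (((5 * F.L : ℕ) : ℝ) ^ 2 / 4) * θ i ≤ α) →
        (∑ i ∈ Finset.range (K - J), (((5 * F.L : ℕ) : ℝ) ^ 2 / 4) * θ (K - i)) ≤ α →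
        α ≤ 1 / 24 → α < deltaSU (Fin 2) → 157 * α < ((F.L : ℝ) ^ 2)⁻¹ → α ≤ α₀ →
        ∀ U₀ : GaugeField (F.P K) 0 (Matrix.specialUnitaryGroup (Fin 2) ℂ), U₀ ∈ histGood F ℰp θ K J →
        G F J (descendTo F ℰp J K hJK U₀) →
        (∀ t, t ≤ K - J → ∀ p : Plaq (F.P K) t,
          dist1 (GaugeField.plaqHol (Averaging.iter (fun k => BlockAveraging.blockAvg (P := F.P K) (j := k) ℰp) t U₀) p) ≤
            C_B * α * (F.L : ℝ) ^ (2 * t) * ((F.L : ℝ)⁻¹) ^ (2 * (K - J))) →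
        ∀ ζ : PBond (F.P K) 0 → EuclideanSpace ℝ (Fin 3), (∀ ℓ, ‖ζ ℓ‖ ≤ Real.pi) →
          (fun ℓ => expPoint (ζ ℓ) * U₀ ℓ : GaugeField (F.P K) 0 (Matrix.specialUnitaryGroup (Fin 2) ℂ)) ∈ histGood F ℰp θ K J →
            descendTo F ℰp J K hJK (fun ℓ => expPoint (ζ ℓ) * U₀ ℓ : GaugeField (F.P K) 0 (Matrix.specialUnitaryGroup (Fin 2) ℂ)) = descendTo F ℰp J K hJK U₀ →
            ∀ (wt : (j : ℕ) → PBond (F.P K) j → PBond (F.P K) (j + 1) → ℝ)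
            (lift : (j : ℕ) → GaugeField (F.P K) (j + 1) SU2 → GaugeField (F.P K) j SU2)
            (U₁ : GaugeField (F.P K) 0 SU2) (g g₀ : (j : ℕ) → Site (F.P K) j → SU2),
          (∀ j b e, wt j b e = if e.dir = b.dir ∧ (b.src b.dir - emb e.src b.dir).val < (F.P K).L then
              ∏ ν ∈ Finset.univ.erase b.dir, max 0 (1 - ((rel (emb e.src) b.src ν).natAbs : ℝ) / (F.P K).L) else 0) →
          (∀ j X b, lift j X b = expPoint (∑ e, wt j b e • ((((F.P K).L : ℕ) : ℝ)⁻¹ • logVec (su2Quat (X e))))) →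
          (∀ j, j < K - J → ∀ x, g j x =
            (axialT (lift j (GaugeField.gaugeAct (g (j + 1)) (Averaging.iter (fun k => blockAvg (P := F.P K) (j := k) ℰp) (j + 1) (fun ℓ => expPoint (ζ ℓ) * U₀ ℓ))))
                (emb (blockOf x)) x)⁻¹ *
              g (j + 1) (blockOf x) * axialT (Averaging.iter (fun k => blockAvg (P := F.P K) (j := k) ℰp) j (fun ℓ => expPoint (ζ ℓ) * U₀ ℓ)) (emb (blockOf x)) x) →
          (∀ j, K - J ≤ j → ∀ y, g j y = 1) →
          (∀ j, j < K - J → ∀ y : Site (F.P K) (j + 1), g j (emb y) = g (j + 1) y) →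
          (∀ X : GaugeField (F.P K) 0 SU2, ∀ j, j ≤ K - J →
            Averaging.iter (fun k => blockAvg (P := F.P K) (j := k) ℰp) j (GaugeField.gaugeAct (g 0) X) =
              GaugeField.gaugeAct (g j) (Averaging.iter (fun k => blockAvg (P := F.P K) (j := k) ℰp) j X)) →
          (∀ j, j < K - J → ∀ x,
            axialT (GaugeField.gaugeAct (g j) (Averaging.iter (fun k => blockAvg (P := F.P K) (j := k) ℰp) j (fun ℓ => expPoint (ζ ℓ) * U₀ ℓ))) (emb (blockOf x)) x =
              axialT (lift j (GaugeField.gaugeAct (g (j + 1)) (Averaging.iter (fun k => blockAvg (P := F.P K) (j := k) ℰp) (j + 1) (fun ℓ => expPoint (ζ ℓ) * U₀ ℓ))))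
                (emb (blockOf x)) x) →
          (∀ j, j < K - J →
            (blockAvg (P := F.P K) (j := j) ℰp).avg (GaugeField.gaugeAct (g j) (Averaging.iter (fun k => blockAvg (P := F.P K) (j := k) ℰp) j (fun ℓ => expPoint (ζ ℓ) * U₀ ℓ))) =
              GaugeField.gaugeAct (g (j + 1)) (Averaging.iter (fun k => blockAvg (P := F.P K) (j := k) ℰp) (j + 1) (fun ℓ => expPoint (ζ ℓ) * U₀ ℓ))) →
          (∀ j, j < K - J → ∀ x, g₀ j x =
            (axialT (lift j (GaugeField.gaugeAct (g₀ (j + 1)) (Averaging.iter (fun k => blockAvg (P := F.P K) (j := k) ℰp) (j + 1) U₁)))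
                (emb (blockOf x)) x)⁻¹ *
              g₀ (j + 1) (blockOf x) * axialT (Averaging.iter (fun k => blockAvg (P := F.P K) (j := k) ℰp) j U₁) (emb (blockOf x)) x) →
          (∀ j, K - J ≤ j → ∀ y, g₀ j y = 1) →
          (∀ j, j < K - J → ∀ y : Site (F.P K) (j + 1), g₀ j (emb y) = g₀ (j + 1) y) →
          (∀ X : GaugeField (F.P K) 0 SU2, ∀ j, j ≤ K - J →
            Averaging.iter (fun k => blockAvg (P := F.P K) (j := k) ℰp) j (GaugeField.gaugeAct (g₀ 0) X) =
              GaugeField.gaugeAct (g₀ j) (Averaging.iter (fun k => blockAvg (P := F.P K) (j := k) ℰp) j X)) →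
          (∀ j, j < K - J → ∀ x,
            axialT (GaugeField.gaugeAct (g₀ j) (Averaging.iter (fun k => blockAvg (P := F.P K) (j := k) ℰp) j U₁)) (emb (blockOf x)) x =
              axialT (lift j (GaugeField.gaugeAct (g₀ (j + 1)) (Averaging.iter (fun k => blockAvg (P := F.P K) (j := k) ℰp) (j + 1) U₁)))
                (emb (blockOf x)) x) →
          (∀ j, j < K - J →
            (blockAvg (P := F.P K) (j := j) ℰp).avg (GaugeField.gaugeAct (g₀ j) (Averaging.iter (fun k => blockAvg (P := F.P K) (j := k) ℰp) j U₁)) =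
              GaugeField.gaugeAct (g₀ (j + 1)) (Averaging.iter (fun k => blockAvg (P := F.P K) (j := k) ℰp) (j + 1) U₁)) →
          (∀ X : GaugeField (F.P K) 0 SU2, Averaging.iter (fun k => blockAvg (P := F.P K) (j := k) ℰp) (K - J) (GaugeField.gaugeAct (fun x => (g 0 x)⁻¹) X) = Averaging.iter (fun k => blockAvg (P := F.P K) (j := k) ℰp) (K - J) X) →
          (∀ X : GaugeField (F.P K) 0 SU2, Averaging.iter (fun k => blockAvg (P := F.P K) (j := k) ℰp) (K - J) (GaugeField.gaugeAct (g₀ 0) X) = Averaging.iter (fun k => blockAvg (P := F.P K) (j := k) ℰp) (K - J) X) →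
          U₀ = GaugeField.gaugeAct (fun x => (g 0 x)⁻¹ * g₀ 0 x) U₁ →

                      ∀ i, 1 ≤ i → i < K - J → ∀ e : PBond (F.P K) i,
            ‖logVec (su2Quat (GaugeField.gaugeAct (g i) (Averaging.iter (fun k => blockAvg (P := F.P K) (j := k) ℰp) i (fun ℓ => expPoint (ζ ℓ) * U₀ ℓ)) e))‖ ≤ 1 / 4 ∧
            ‖logVec (su2Quat (GaugeField.gaugeAct (g₀ i) (Averaging.iter (fun k => blockAvg (P := F.P K) (j := k) ℰp) i U₁) e))‖ ≤ 1 / 4 :=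
  arcLetter4_of_guard G fun F J V h e => (hGs F J V h e).trans hs₀

end Summit.QuantumFields.YangMills.Theorems.FluctuationComparisonRegPrIntLS2BetaArcLetterSigmaOfGuard

end
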